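import Mathlib.Analysis.Calculus.Deriv.MeanValue
import Literature.Computability.QuantumComplexity.GuidedLocalHamiltonianDecision
import Summits.QuantumAdvantage.Dequantization.SignPolynomialNeedle

/-!
# An explicit sign polynomial with a degree bound, and GL22 §4 without cited analytic input

HONEST FRAMING: instance-level adjudication of specific advantage claims; no claim about
BQP vs BPP or the summit.

Context (cell pub-qadeq, the in-tree "Gharibian–Le Gall road" of sparse-access dequantization:
`Literature/Computability/QuantumComplexity/SparseQSVTEstimation.lean` (GL22 §4.1 Lemma 3 /
Theorem 3, §4.2 Theorem 4, §4.3 scan), `RectanglePolynomial.lean` (§4.2 Lemma 4) and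
`GuidedLocalHamiltonianDecision.lean` (§4.3 Proposition 1, Theorem 1 assembled)).  Those files take
the Low–Chuang / GSLW19-Lemma-25 sign polynomial as the HYPOTHESIS CLASS `SignApprox η ξ p`
(`|p| ≤ 1` on `[−2,2]`, `p ≤ −1+ξ` on `[−2,−η]`, `p ≥ 1−ξ` on `[η,2]`) and cite its degree bound
`O(log(1/ξ)/η)`; the class is shown non-empty only by Weierstrass (no degree bound).

This file (with the algebraic part I, `SignPolynomialNeedle.lean`) is OUR construction (new work, hence
under `Summits/`, not `Literature/`): an explicit
real polynomial in `SignApprox η ξ` of degree `≤ 4m + 1` for every `m` with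
`(1 + 4η/5)^{2m} ≥ 16/(ηξ)` — in particular of degree `≤ 5·ln(16/(ηξ))/η + 5`
(`exists_signApprox_natDegree_le`).  This is WEAKER than the cited `O(log(1/ξ)/η)` by the
additive `O(log(1/η)/η)` term (the optimal order is `Θ(log(1/ξ)/η)` for small `ξ`, Eremenko–Yuditskii
2007); it is elementary (Chebyshev polynomials, one antiderivative, the mean value inequality) and
it suffices to make the GL22 §4 chain free of cited-but-unproved analytic input: for the constant
parameters of GL22 Theorem 1 / Proposition 1 every degree in sight is a constant either way
(`groundEnergy_estimate_explicit`).

Construction ("integrated Chebyshev needle").  With `c = 2/(4−η²)` and `u(t) = 1 + c(η² − t²)`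
(so `u(±η) = 1`, `u(±2) = −1`, `u ∈ [−1,1]` for `η ≤ |t| ≤ 2`, `u ≥ 1 + 3η²/8` for `|t| ≤ η/2`),
let `b(t) = T_m(u(t))²` (`T_m` the Chebyshev polynomial): `0 ≤ b`, `b ≤ 1` on `η ≤ |t| ≤ 2`, and
`b ≥ (1+4η/5)^{2m}/4` on `|t| ≤ η/2` (from `T_m(cosh θ) = cosh(mθ) ≥ e^{mθ}/2` and
`e^θ = u + √(u²−1) ≥ 1 + 4η/5`).  Let `P(x) = ∫₀ˣ b` (an odd polynomial, written algebraically as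
`X · q̃(X²)` with `q̃ = ∑ q_k X^k/(2k+1)` for `b = q(X²)`) and `p = P/P(2)`.  Then `p` is odd and
increasing, `|p| ≤ 1` on `[−2,2]`, and for `x ∈ [η,2]`:
`1 − p(x) = (P(2) − P(x))/P(2) ≤ 2/P(η/2) ≤ 16/(η(1+4η/5)^{2m}) ≤ ξ`.

No named facts, no axioms beyond the standard three, no `sorry`.

References (for context; nothing here is a restatement of them): G. H. Low, I. L. Chuang,
arXiv:1707.05391 (constructive sign approximation of degree `O(log(1/ε)/δ)`); A. Gilyén, Y. Su,
G. H. Low, N. Wiebe, STOC 2019 (arXiv:1806.01838 Lemma 24 / STOC Lemma 25); A. Eremenko,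
P. Yuditskii, "Uniform approximation of sgn x by polynomials and entire functions",
J. Anal. Math. 101 (2007) 313–324 (optimal constants); S. Gharibian, F. Le Gall, STOC 2022
(arXiv:2111.09079) §4.
-/

noncomputable section

namespace Summit.QuantumAdvantage.Dequantization.SignPolynomial

open Polynomial Finset Matrix
open Literature.Computability.QuantumComplexity
open Literature.Computability.QuantumComplexity.SampleQuery

/-! ### Analysis of `P = ∫₀ b` and `p = P/P(2)` -/

section analysis

variable {η : ℝ} (hη : 0 < η) (hη1 : η ≤ 1) (m : ℕ)
include hη hη1

omit hη hη1 in
/-- `P` is increasing (`P' = b ≥ 0`). -/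
theorem signPolyRaw_monotone : Monotone fun x => (signPolyRaw η m).eval x := by
  refine monotone_of_deriv_nonneg (Polynomial.differentiable _) fun x => ?_
  rw [signPolyRaw, deriv_oddAntideriv]
  exact eval_needleSq_nonneg η m _

/-- `P(η/2) ≥ (η/2)·((1+4η/5)^m/2)²` (mean value inequality on `[0, η/2]`, `P(0) = 0`). -/
theorem signPolyRaw_half_ge :
    η / 2 * ((1 + 4 * η / 5) ^ m / 2) ^ 2 ≤ (signPolyRaw η m).eval (η / 2) := by
  set f : ℝ → ℝ := fun x => (signPolyRaw η m).eval x with hf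
  have hD : Convex ℝ (Set.Icc (0 : ℝ) (η / 2)) := convex_Icc _ _
  have hcont : ContinuousOn f (Set.Icc (0 : ℝ) (η / 2)) :=
    (Polynomial.continuous _).continuousOn
  have hdiff : DifferentiableOn ℝ f (interior (Set.Icc (0 : ℝ) (η / 2))) :=
    (Polynomial.differentiable _).differentiableOn
  have hge : ∀ x ∈ interior (Set.Icc (0 : ℝ) (η / 2)),
      ((1 + 4 * η / 5) ^ m / 2) ^ 2 ≤ deriv f x := by
    intro x hx
    rw [interior_Icc] at hx
    rw [hf, signPolyRaw, deriv_oddAntideriv]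
    refine eval_needleSq_ge hη hη1 m ?_
    have h1 : 0 ≤ x := hx.1.le
    have h2 : x ≤ η / 2 := hx.2.le
    nlinarith
  have h := hD.mul_sub_le_image_sub_of_le_deriv hcont hdiff hge 0
    (Set.left_mem_Icc.2 (by linarith)) (η / 2) (Set.right_mem_Icc.2 (by linarith)) (by linarith)
  have h0 : f 0 = 0 := eval_oddAntideriv_zero _
  rw [h0, sub_zero, sub_zero] at h
  linarith

/-- `P(2) ≥ P(η/2) > 0`. -/
theorem signPolyRaw_two_pos : 0 < (signPolyRaw η m).eval 2 := by
  have h1 := signPolyRaw_half_ge hη hη1 m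
  have h2 : (signPolyRaw η m).eval (η / 2) ≤ (signPolyRaw η m).eval 2 :=
    signPolyRaw_monotone (η := η) m (by linarith)
  have h3 : 0 < η / 2 * ((1 + 4 * η / 5) ^ m / 2) ^ 2 := by positivity
  linarith

/-- For `x ∈ [η, 2]`: `P(2) − P(x) ≤ 2 − x ≤ 2` (`P' = b ≤ 1` there). -/
theorem signPolyRaw_two_sub_le {x : ℝ} (hx1 : η ≤ x) (hx2 : x ≤ 2) :
    (signPolyRaw η m).eval 2 - (signPolyRaw η m).eval x ≤ 2 - x := by
  set f : ℝ → ℝ := fun x => (signPolyRaw η m).eval x with hf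
  have hD : Convex ℝ (Set.Icc η 2) := convex_Icc _ _
  have hcont : ContinuousOn f (Set.Icc η 2) := (Polynomial.continuous _).continuousOn
  have hdiff : DifferentiableOn ℝ f (interior (Set.Icc η 2)) :=
    (Polynomial.differentiable _).differentiableOn
  have hle : ∀ y ∈ interior (Set.Icc η 2), deriv f y ≤ 1 := by
    intro y hy
    rw [interior_Icc] at hy
    rw [hf, signPolyRaw, deriv_oddAntideriv]
    refine eval_needleSq_le_one hη hη1 m ?_ ?_
    · nlinarith [hy.1, hη]
    · nlinarith [hy.1, hy.2, hη]
  have h := hD.image_sub_le_mul_sub_of_deriv_le hcont hdiff hle x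
    (Set.mem_Icc.2 ⟨hx1, hx2⟩) 2 (Set.right_mem_Icc.2 (by linarith)) hx2
  simpa [hf] using h

omit hη hη1 in
/-- `p(x) = P(x)/P(2)`. -/
theorem eval_signPoly (x : ℝ) :
    (signPoly η m).eval x = (signPolyRaw η m).eval x / (signPolyRaw η m).eval 2 := by
  rw [signPoly, eval_mul, eval_C]
  ring

omit hη hη1 in
/-- `p` is odd. -/
theorem eval_signPoly_neg (x : ℝ) : (signPoly η m).eval (-x) = -(signPoly η m).eval x := by
  rw [eval_signPoly, eval_signPoly, signPolyRaw, eval_oddAntideriv_neg]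
  ring

/-- `0 ≤ p(x) ≤ 1` for `x ∈ [0,2]`. -/
theorem signPoly_mem_Icc {x : ℝ} (hx0 : 0 ≤ x) (hx2 : x ≤ 2) :
    0 ≤ (signPoly η m).eval x ∧ (signPoly η m).eval x ≤ 1 := by
  have hpos := signPolyRaw_two_pos hη hη1 m
  have hmono := signPolyRaw_monotone (η := η) m
  have h0 : (signPolyRaw η m).eval 0 ≤ (signPolyRaw η m).eval x := hmono hx0
  have h2 : (signPolyRaw η m).eval x ≤ (signPolyRaw η m).eval 2 := hmono hx2
  rw [signPolyRaw, eval_oddAntideriv_zero] at h0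
  rw [eval_signPoly]
  exact ⟨div_nonneg (by rw [signPolyRaw]; exact h0) hpos.le, by rw [div_le_one hpos]; exact h2⟩

/-- For `x ∈ [η,2]`: `p(x) ≥ 1 − 16/(η(1+4η/5)^{2m})`. -/
theorem signPoly_ge {x : ℝ} (hx1 : η ≤ x) (hx2 : x ≤ 2) :
    1 - 16 / (η * (1 + 4 * η / 5) ^ (2 * m)) ≤ (signPoly η m).eval x := by
  have hpos := signPolyRaw_two_pos hη hη1 m
  have hhalf := signPolyRaw_half_ge hη hη1 m
  have hmono := signPolyRaw_monotone (η := η) m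
  have hP2 : η / 2 * ((1 + 4 * η / 5) ^ m / 2) ^ 2 ≤ (signPolyRaw η m).eval 2 :=
    hhalf.trans (hmono (by linarith))
  have hsub := signPolyRaw_two_sub_le hη hη1 m hx1 hx2
  have hL : 0 < η / 2 * ((1 + 4 * η / 5) ^ m / 2) ^ 2 := by positivity
  have hpow : ((1 + 4 * η / 5) ^ m / 2) ^ 2 = (1 + 4 * η / 5) ^ (2 * m) / 4 := by
    rw [div_pow, ← pow_mul, mul_comm m 2]; norm_num
  rw [eval_signPoly]
  -- 1 - p(x) = (P2 - Px)/P2 ≤ 2/P2 ≤ 2/(η/2·L) = 16/(η (1+4η/5)^{2m})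
  have hkey : 1 - (signPolyRaw η m).eval x / (signPolyRaw η m).eval 2
      = ((signPolyRaw η m).eval 2 - (signPolyRaw η m).eval x) / (signPolyRaw η m).eval 2 := by
    field_simp
  have h1 : ((signPolyRaw η m).eval 2 - (signPolyRaw η m).eval x) / (signPolyRaw η m).eval 2
      ≤ 2 / (η / 2 * ((1 + 4 * η / 5) ^ m / 2) ^ 2) := by
    rw [div_le_div_iff₀ hpos hL]
    have hx0 : 0 ≤ x := le_trans hη.le hx1
    nlinarith
  have h2 : 2 / (η / 2 * ((1 + 4 * η / 5) ^ m / 2) ^ 2) = 16 / (η * (1 + 4 * η / 5) ^ (2 * m)) := by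
    rw [hpow]
    field_simp
    ring
  linarith [hkey.symm.le, hkey.le]

/-- **The construction lands in the cited hypothesis class**: for `0 < η ≤ 1` and
`(1+4η/5)^{2m} ≥ 16/(ηξ)`, `signPoly η m ∈ SignApprox η ξ`. -/
theorem signPoly_signApprox {ξ : ℝ} (hξ : 0 < ξ)
    (hm : 16 / (η * ξ) ≤ (1 + 4 * η / 5) ^ (2 * m)) : SignApprox η ξ (signPoly η m) := by
  have hgap : 16 / (η * (1 + 4 * η / 5) ^ (2 * m)) ≤ ξ := by
    have hp : 0 < (1 + 4 * η / 5) ^ (2 * m) := by positivity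
    rw [div_le_iff₀ (mul_pos hη hp)]
    rw [div_le_iff₀ (mul_pos hη hξ)] at hm
    nlinarith
  refine ⟨?_, ?_, ?_⟩
  · intro x h1 h2
    rcases le_or_gt 0 x with hx | hx
    · obtain ⟨a, b⟩ := signPoly_mem_Icc hη hη1 m hx h2
      rw [abs_le]; exact ⟨by linarith, b⟩
    · obtain ⟨a, b⟩ := signPoly_mem_Icc hη hη1 m (x := -x) (by linarith) (by linarith)
      rw [eval_signPoly_neg] at a b
      rw [abs_le]; exact ⟨by linarith, by linarith⟩
  · intro x h1 h2
    have h := signPoly_ge hη hη1 m (x := -x) (by linarith) (by linarith)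
    rw [eval_signPoly_neg] at h
    linarith
  · intro x h1 h2
    have h := signPoly_ge hη hη1 m h1 h2
    linarith

end analysis

/-! ### Choosing `m`: `m ≥ 5·ln(16/(ηξ))/(4η)` suffices -/

/-- `e^{a/2} ≤ 1 + a` for `0 ≤ a ≤ 1`. -/
private theorem exp_half_le {a : ℝ} (ha0 : 0 ≤ a) (ha1 : a ≤ 1) : Real.exp (a / 2) ≤ 1 + a := by
  have h1 : -(a / 2) + 1 ≤ Real.exp (-(a / 2)) := Real.add_one_le_exp _
  have h2 : Real.exp (-(a / 2)) * Real.exp (a / 2) = 1 := by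
    rw [← Real.exp_add]; simp
  have hpos : 0 < Real.exp (a / 2) := Real.exp_pos _
  -- (1 - a/2) e^{a/2} ≤ 1 and (1 - a/2)(1 + a) ≥ 1
  nlinarith [mul_le_mul_of_nonneg_right h1 hpos.le]

/-- If `m ≥ 5·ln(16/(ηξ))/(4η)` then `(1+4η/5)^{2m} ≥ 16/(ηξ)`. -/
theorem pow_ge_of_le_m {η ξ : ℝ} (hη : 0 < η) (hη1 : η ≤ 1) (hξ : 0 < ξ) {m : ℕ}
    (hm : 5 * Real.log (16 / (η * ξ)) / (4 * η) ≤ m) :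
    16 / (η * ξ) ≤ (1 + 4 * η / 5) ^ (2 * m) := by
  set a := 4 * η / 5 with ha
  have ha0 : 0 ≤ a := by positivity
  have ha1 : a ≤ 1 := by rw [ha]; linarith
  have hK : 0 < 16 / (η * ξ) := by positivity
  have hexp : Real.exp (a / 2) ^ (2 * m) ≤ (1 + a) ^ (2 * m) :=
    pow_le_pow_left₀ (Real.exp_pos _).le (exp_half_le ha0 ha1) _
  have hma : Real.log (16 / (η * ξ)) ≤ m * a := by
    rw [ha]
    have h4 : 0 < 4 * η := by positivity
    rw [div_le_iff₀ h4] at hm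
    linarith
  calc 16 / (η * ξ) = Real.exp (Real.log (16 / (η * ξ))) := (Real.exp_log hK).symm
    _ ≤ Real.exp (m * a) := Real.exp_le_exp.2 hma
    _ = Real.exp (a / 2) ^ (2 * m) := by
        rw [← Real.exp_nat_mul]; congr 1; push_cast; ring
    _ ≤ (1 + a) ^ (2 * m) := hexp

/-- **Explicit sign polynomial with a degree bound.**  For `0 < η ≤ 1` and `0 < ξ ≤ 1` there is a
real polynomial `p` with `|p| ≤ 1` on `[−2,2]`, `p ≤ −1+ξ` on `[−2,−η]`, `p ≥ 1−ξ` on `[η,2]`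
(`SignApprox η ξ p`) and `deg p ≤ 5·ln(16/(ηξ))/η + 5`.  (The cited Low–Chuang / GSLW bound is
`O(log(1/ξ)/η)`; ours carries the extra `log(1/η)/η`.) -/
theorem exists_signApprox_natDegree_le {η ξ : ℝ} (hη : 0 < η) (hη1 : η ≤ 1) (hξ : 0 < ξ)
    (hξ1 : ξ ≤ 1) :
    ∃ p : ℝ[X], SignApprox η ξ p ∧
      (p.natDegree : ℝ) ≤ 5 * Real.log (16 / (η * ξ)) / η + 5 := by
  set L := 5 * Real.log (16 / (η * ξ)) / (4 * η) with hL
  have hlog : 0 ≤ Real.log (16 / (η * ξ)) := by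
    refine Real.log_nonneg ?_
    rw [le_div_iff₀ (mul_pos hη hξ)]
    nlinarith [mul_le_mul hη1 hξ1 hξ.le zero_le_one]
  have hL0 : 0 ≤ L := by positivity
  set m := ⌈L⌉₊ with hm
  have hmL : L ≤ m := Nat.le_ceil L
  have hm1 : (m : ℝ) < L + 1 := Nat.ceil_lt_add_one hL0
  refine ⟨signPoly η m, signPoly_signApprox hη hη1 m hξ (pow_ge_of_le_m hη hη1 hξ hmL), ?_⟩
  have hdeg := natDegree_signPoly_le η m
  have hdeg' : ((signPoly η m).natDegree : ℝ) ≤ 4 * m + 1 := by exact_mod_cast hdeg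
  have h4 : 4 * (L + 1) + 1 = 5 * Real.log (16 / (η * ξ)) / η + 5 := by
    rw [hL]; field_simp; ring
  nlinarith

/-! ### GL22 Theorem 1 with explicit polynomials (no cited analytic hypothesis left) -/

/-- **GL22 Theorem 1, real case, every input explicit.**  `groundEnergy_estimate` of
`GuidedLocalHamiltonianDecision.lean` run with the sign polynomials of this file:
`p₁ = signPoly (1/4) m₁`, `p₂ = signPoly (1/(8r)) m₂`, any `m₁, m₂` with
`(1 + 1/5)^{2m₁} ≥ 64/ξ`, `(1 + 1/(10r))^{2m₂} ≥ 128r/ξ` (`ξ = 2δ²/15`; e.g.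
`mᵢ ≥ 5 ln(16/(ηᵢξ))/(4ηᵢ)` by `pow_ge_of_le_m`) and `d = 2·max(m₁,m₂)` (so each entry evaluation
costs `∑_{k≤d} s^{2k}` queries by Lemma 3): the scan output is within `1/r` of `λ_H` except on
outcomes of total weight `≤ 2r·η`. -/
theorem groundEnergy_estimate_explicit {N s r m₁ m₂ : ℕ} (hr0 : 0 < r)
    (H : Matrix (Fin N) (Fin N) ℝ) (hH : Hᵀ = H)
    (hH1 : ∀ x : Fin N → ℝ, normSq (H *ᵥ x) ≤ normSq x) (u : Fin N → ℝ) (hu : normSq u ≤ 1)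
    {rowO colO : SparseQuery.RowOracle (Fin N) (Fin N) ℝ}
    (hro : rowO.Lists (shifted H)) (hco : colO.Lists (shifted H)ᵀ) (hrw : rowO.Width s)
    (hcw : colO.Width s) {ζ : ℝ} (S : ZetaSampling ζ u) (h0 : 0 ≤ ζ)
    {δ : ℝ} (hδ : 0 < δ) (hδ1 : δ ≤ 1) (hζ : ζ ≤ δ ^ 2 / 56)
    {lam : ℝ} {g : Fin N → ℝ} (hg : H *ᵥ g = lam • g) (hg1 : normSq g = 1) (hgu : δ ≤ g ⬝ᵥ u)
    (hmin : ∀ y : Fin N → ℝ, lam * normSq y ≤ y ⬝ᵥ (H *ᵥ y))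
    (hm₁ : 16 / (1 / 4 * (2 * (δ ^ 2 / 3) / 5)) ≤ (1 + 4 * (1 / 4) / 5) ^ (2 * m₁))
    (hm₂ : 16 / (1 / (8 * r) * (2 * (δ ^ 2 / 3) / 5)) ≤ (1 + 4 * (1 / (8 * r)) / 5) ^ (2 * m₂))
    {η : ℝ} (hη : 0 < η) {x q : ℕ} (hx : 1024 / (δ ^ 2 / 7) ^ 2 ≤ (x : ℝ)) (hq : 0 < q)
    (hqη : 8 * Real.log (1 / η) ≤ q) (med : Fin (2 * r) → (Fin q → Fin x → Fin N) → ℝ)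
    (hmed : ∀ j ω, Literature.Computability.Complexity.IsMedian
      (fun i => blockMean (S.est (SparseQuery.recEvalPoly
        (evenCoeffs (scanPoly r δ (signPoly (1 / 4) m₁) (signPoly (1 / (8 * r)) m₂) j)
          (2 * max m₁ m₂)) (rowO.gram colO) u)) (ω i)) (med j ω)) :
    ∑ ω ∈ univ.filter (fun ω : Fin (2 * r) → (Fin q → Fin x → Fin N) =>
        1 / (r : ℝ) < |(((univ.filter fun j => med j (ω j) ≤ δ ^ 2 / 2).card : ℝ) - r) / r - lam|),
      ∏ j, ∏ i, iidWeight S.p (ω j i) ≤ 2 * r * η := by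
  have hξ : 0 < 2 * (δ ^ 2 / 3) / 5 := by positivity
  have hr' : (0 : ℝ) < r := Nat.cast_pos.2 hr0
  have hη₂ : 0 < 1 / (8 * (r : ℝ)) := by positivity
  have hη₂1 : 1 / (8 * (r : ℝ)) ≤ 1 := by
    rw [div_le_one (by positivity)]
    have : (1 : ℝ) ≤ r := by exact_mod_cast hr0
    linarith
  have h₁ := signPoly_signApprox (by norm_num : (0 : ℝ) < 1 / 4) (by norm_num) m₁ hξ hm₁
  have h₂ := signPoly_signApprox hη₂ hη₂1 m₂ hξ hm₂
  have hd : max (signPoly (1 / 4) m₁).natDegree (signPoly (1 / (8 * (r : ℝ))) m₂).natDegree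
      ≤ 2 * (2 * max m₁ m₂) + 1 := by
    refine max_le ?_ ?_
    · refine (natDegree_signPoly_le _ _).trans ?_
      have := le_max_left m₁ m₂; omega
    · refine (natDegree_signPoly_le _ _).trans ?_
      have := le_max_right m₁ m₂; omega
  exact groundEnergy_estimate hr0 H hH hH1 u hu hro hco hrw hcw S h0 hδ hδ1 hζ hg hg1 hgu hmin
    h₁ h₂ hd hη hx hq hqη med hmed

end Summit.QuantumAdvantage.Dequantization.SignPolynomial

end
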